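import Literature.Computability.Complexity.SymmetricColourRefinement
import HarnessLib

/-!
# Symmetric threshold circuits for ordered colour refinement and the canonical form, II:
# size and symmetry

Continuation of `SymmetricColourRefinement.lean` (the DAG `SymCR.crDAG m T o` on the gate type
`SymCR.Node m T`).

* `SymCR.card_node_le` — the circuit has at most `22·(m+1)⁴·(T+1)` gates (a surjection from a
  sum of products of `Fin`s), hence `SymCR.compile_crDAG_size_le`;
* `SymCR.crDAG_isAut` — for EVERY permutation `ρ` of the vertices, renaming vertex parameters
  (`SymCR.Node.act ρ`; round and rank parameters stay put) is an automorphism of the DAG over the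
  diagonal action `(u, v) ↦ (ρ u, ρ v)` on the inputs: gate functions are preserved and every
  argument tuple is carried to the renamed tuple up to a permutation of the positions (block
  permutations for the two-block majority gates, `consPerm` for the `(1 + m)`-ary conjunctions,
  `prodPerm` for the `m²`-ary output disjunctions);
* hence the compiled straight-line circuits are symmetric under every set of vertex permutations
  (`SymCR.compile_crDAG_isSymmetricUnder`, via `GateDAG.isSymmetricUnder_compile_iff`), over
  `tcBasis` (`SymCR.compile_crDAG_isOver`) — Anderson–Dawar's "FPC formulas give symmetric
  threshold circuits" (2017, Thm 1, §3) for this particular formula.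

## References

* [AndersonDawar2016] M. Anderson, A. Dawar, *On symmetric circuits and fixed-point logics*,
  Theory Comput. Syst. 60 (2017), Def. 6–7, Thm 1, §3.
-/

namespace Literature.Computability.Complexity

open Finset

namespace SymCR

open Node

variable {m T : ℕ}

/-! ### Size -/

set_option maxHeartbeats 800000 in
/-- **Size of the circuit**: at most `22·(m+1)⁴·(T+1)` gates. [folklore] -/
theorem card_node_le (m T : ℕ) : Fintype.card (Node m T) ≤ 22 * ((m + 1) ^ 4 * (T + 1)) := by
  let V := Fin m
  let R := Fin T
  let S := Fin 2 ⊕ (Fin 3 × V × V) ⊕ (Fin 2 × Fin (T + 1) × V × V) ⊕ (Fin 7 × R × V × V × V) ⊕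
    (Fin 3 × R × V × V) ⊕ (R × V × V × V × V) ⊕ (Fin 2 × V × Fin (m + 1)) ⊕ (V × V) ⊕ (V × V × V × V)
  let ψ : S → Node m T := fun s =>
    match s with
    | .inl k => if (k : ℕ) = 0 then tt else ff
    | .inr (.inl ⟨k, u, v⟩) => if (k : ℕ) = 0 then e u v else if (k : ℕ) = 1 then adj u v else y u v
    | .inr (.inr (.inl ⟨k, t, u, v⟩)) => if (k : ℕ) = 0 then eq t u v else lt t u v
    | .inr (.inr (.inr (.inl ⟨k, t, u, v, w⟩))) =>
        if (k : ℕ) = 0 then ae t u v w else if (k : ℕ) = 1 then nae t u v w else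
        if (k : ℕ) = 2 then cge t u v w else if (k : ℕ) = 3 then ceq t u v w else
        if (k : ℕ) = 4 then clt t u v w else if (k : ℕ) = 5 then allb t u v w else lexw t u v w
    | .inr (.inr (.inr (.inr (.inl ⟨k, t, u, v⟩)))) =>
        if (k : ℕ) = 0 then lex t u v else if (k : ℕ) = 1 then lt2 t u v else nlt t u v
    | .inr (.inr (.inr (.inr (.inr (.inl ⟨t, u, v, w, w'⟩))))) => imp t u v w w'
    | .inr (.inr (.inr (.inr (.inr (.inr (.inl ⟨k, u, i⟩)))))) =>
        if (k : ℕ) = 0 then rge u i else nrge u i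
    | .inr (.inr (.inr (.inr (.inr (.inr (.inr (.inl ⟨u, i⟩))))))) => rk u i
    | .inr (.inr (.inr (.inr (.inr (.inr (.inr (.inr ⟨i, j, u, v⟩))))))) => yt i j u v
  have hψ : Function.Surjective ψ := by
    intro l
    cases l with
    | tt => exact ⟨.inl 0, rfl⟩
    | ff => exact ⟨.inl 1, rfl⟩
    | e u v => exact ⟨.inr (.inl ⟨0, u, v⟩), rfl⟩
    | adj u v => exact ⟨.inr (.inl ⟨1, u, v⟩), rfl⟩
    | y i j => exact ⟨.inr (.inl ⟨2, i, j⟩), rfl⟩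
    | eq t u v => exact ⟨.inr (.inr (.inl ⟨0, t, u, v⟩)), rfl⟩
    | lt t u v => exact ⟨.inr (.inr (.inl ⟨1, t, u, v⟩)), rfl⟩
    | ae t u w' w => exact ⟨.inr (.inr (.inr (.inl ⟨0, t, u, w', w⟩))), rfl⟩
    | nae t u w' w => exact ⟨.inr (.inr (.inr (.inl ⟨1, t, u, w', w⟩))), rfl⟩
    | cge t u v w => exact ⟨.inr (.inr (.inr (.inl ⟨2, t, u, v, w⟩))), rfl⟩
    | ceq t u v w => exact ⟨.inr (.inr (.inr (.inl ⟨3, t, u, v, w⟩))), rfl⟩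
    | clt t u v w => exact ⟨.inr (.inr (.inr (.inl ⟨4, t, u, v, w⟩))), rfl⟩
    | allb t u v w => exact ⟨.inr (.inr (.inr (.inl ⟨5, t, u, v, w⟩))), rfl⟩
    | lexw t u v w => exact ⟨.inr (.inr (.inr (.inl ⟨6, t, u, v, w⟩))), rfl⟩
    | lex t u v => exact ⟨.inr (.inr (.inr (.inr (.inl ⟨0, t, u, v⟩)))), rfl⟩
    | lt2 t u v => exact ⟨.inr (.inr (.inr (.inr (.inl ⟨1, t, u, v⟩)))), rfl⟩
    | nlt t w' w => exact ⟨.inr (.inr (.inr (.inr (.inl ⟨2, t, w', w⟩)))), rfl⟩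
    | imp t u v w w' => exact ⟨.inr (.inr (.inr (.inr (.inr (.inl ⟨t, u, v, w, w'⟩))))), rfl⟩
    | rge u i => exact ⟨.inr (.inr (.inr (.inr (.inr (.inr (.inl ⟨0, u, i⟩)))))), rfl⟩
    | nrge u i => exact ⟨.inr (.inr (.inr (.inr (.inr (.inr (.inl ⟨1, u, i⟩)))))), rfl⟩
    | rk u i => exact ⟨.inr (.inr (.inr (.inr (.inr (.inr (.inr (.inl ⟨u, i⟩))))))), rfl⟩
    | yt i j u v => exact ⟨.inr (.inr (.inr (.inr (.inr (.inr (.inr (.inr ⟨i, j, u, v⟩))))))), rfl⟩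
  have hcard := Fintype.card_le_of_surjective ψ hψ
  -- every summand is at most a small multiple of `B = (m+1)^4 (T+1)`
  set B := (m + 1) ^ 4 * (T + 1) with hB
  have hpow : (m + 1) ^ 4 = (m + 1) * (m + 1) * (m + 1) * (m + 1) := by ring
  have b0 : 1 ≤ B := Nat.mul_pos (Nat.pow_pos (Nat.succ_pos m)) (Nat.succ_pos T)
  have b2 : m * m ≤ B := by
    rw [hB, hpow]
    calc m * m = m * m * 1 * 1 * 1 := by ring
      _ ≤ (m + 1) * (m + 1) * (m + 1) * (m + 1) * (T + 1) := by gcongr <;> omega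
  have b3 : (T + 1) * (m * m) ≤ B := by
    rw [hB, hpow]
    calc (T + 1) * (m * m) = m * m * 1 * 1 * (T + 1) := by ring
      _ ≤ (m + 1) * (m + 1) * (m + 1) * (m + 1) * (T + 1) := by gcongr <;> omega
  have b4 : T * (m * (m * m)) ≤ B := by
    rw [hB, hpow]
    calc T * (m * (m * m)) = m * m * m * 1 * T := by ring
      _ ≤ (m + 1) * (m + 1) * (m + 1) * (m + 1) * (T + 1) := by gcongr <;> omega
  have b5 : T * (m * m) ≤ B := by
    rw [hB, hpow]
    calc T * (m * m) = m * m * 1 * 1 * T := by ring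
      _ ≤ (m + 1) * (m + 1) * (m + 1) * (m + 1) * (T + 1) := by gcongr <;> omega
  have b6 : T * (m * (m * (m * m))) ≤ B := by
    rw [hB, hpow]
    calc T * (m * (m * (m * m))) = m * m * m * m * T := by ring
      _ ≤ (m + 1) * (m + 1) * (m + 1) * (m + 1) * (T + 1) := by gcongr <;> omega
  have b7 : m * (m + 1) ≤ B := by
    rw [hB, hpow]
    calc m * (m + 1) = m * (m + 1) * 1 * 1 * 1 := by ring
      _ ≤ (m + 1) * (m + 1) * (m + 1) * (m + 1) * (T + 1) := by gcongr <;> omega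
  have b8 : m * (m * (m * m)) ≤ B := by
    rw [hB, hpow]
    calc m * (m * (m * m)) = m * m * m * m * 1 := by ring
      _ ≤ (m + 1) * (m + 1) * (m + 1) * (m + 1) * (T + 1) := by gcongr <;> omega
  have hS : Fintype.card S = 2 + (3 * (m * m) + (2 * ((T + 1) * (m * m)) + (7 * (T * (m * (m * m))) +
      (3 * (T * (m * m)) + (T * (m * (m * (m * m))) + (2 * (m * (m + 1)) + (m * m +
      m * (m * (m * m))))))))) := by
    simp only [S, V, R, Fintype.card_sum, Fintype.card_prod, Fintype.card_fin]
  rw [hS] at hcard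
  omega

/-! ### Symmetry: every vertex permutation is an automorphism -/

section Symmetry

/-- The diagonal action on matrix entries, as a permutation. [folklore] -/
abbrev diag (ρ : Equiv.Perm (Fin m)) : Equiv.Perm (Fin m × Fin m) := Equiv.prodCongr ρ ρ

/-- The diagonal permutation as a function. [folklore] -/
theorem coe_diag (ρ : Equiv.Perm (Fin m)) :
    (⇑(diag ρ) : Fin m × Fin m → Fin m × Fin m) = fun q => (ρ q.1, ρ q.2) := rfl

/-- Lists of a permuted and relabelled tuple: if `F ∘ g = f ∘ τ` for a permutation `τ` of the
positions then `ofFn f` is a permutation of `(ofFn g).map F`. [folklore] -/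
theorem perm_of_comp_eq {n : ℕ} {X : Type*} {f g : Fin n → X} {F : X → X} (τ : Equiv.Perm (Fin n))
    (h : ∀ a, F (g a) = f (τ a)) : (List.ofFn f).Perm ((List.ofFn g).map F) := by
  rw [List.map_ofFn]
  have hfg : F ∘ g = f ∘ τ := funext h
  rw [hfg]
  exact (Equiv.Perm.ofFn_comp_perm τ f).symm

/-- The case of equal tuples. [folklore] -/
theorem perm_of_eq {n : ℕ} {X : Type*} {f g : Fin n → X} {F : X → X}
    (h : ∀ a, F (g a) = f a) : (List.ofFn f).Perm ((List.ofFn g).map F) :=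
  perm_of_comp_eq 1 h

/-- The block sum of two permutations, on `Fin (m + n)`. [folklore] -/
def blockPerm {n : ℕ} (ρ₁ : Equiv.Perm (Fin m)) (ρ₂ : Equiv.Perm (Fin n)) : Equiv.Perm (Fin (m + n)) :=
  finSumFinEquiv.symm.trans ((Equiv.sumCongr ρ₁ ρ₂).trans finSumFinEquiv)

/-- `Fin.append` intertwines block sums with componentwise composition. [folklore] -/
theorem append_blockPerm {n : ℕ} {X : Type*} (a : Fin m → X) (b : Fin n → X)
    (ρ₁ : Equiv.Perm (Fin m)) (ρ₂ : Equiv.Perm (Fin n)) (k : Fin (m + n)) :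
    Fin.append a b (blockPerm ρ₁ ρ₂ k) = Fin.append (a ∘ ρ₁) (b ∘ ρ₂) k := by
  induction k using Fin.addCases with
  | left i => simp [blockPerm, Fin.append_left]
  | right j => simp [blockPerm, Fin.append_right]

/-- The permutation of `Fin (m + 1)` fixing `0` and acting by `ρ` on successors. [folklore] -/
def consPerm (ρ : Equiv.Perm (Fin m)) : Equiv.Perm (Fin (m + 1)) :=
  (finSuccEquiv m).trans ((Equiv.optionCongr ρ).trans (finSuccEquiv m).symm)

/-- `Fin.cons` intertwines `consPerm` with composition on the tail. [folklore] -/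
theorem cons_consPerm {X : Type*} (x₀ : X) (p : Fin m → X) (ρ : Equiv.Perm (Fin m)) (k : Fin (m + 1)) :
    (Fin.cons x₀ p : Fin (m + 1) → X) (consPerm ρ k) = (Fin.cons x₀ (p ∘ ρ) : Fin (m + 1) → X) k := by
  refine Fin.cases ?_ (fun i => ?_) k
  · simp [consPerm]
  · simp [consPerm, finSuccEquiv_succ]

/-- The diagonal permutation of `Fin (m * m)` induced by `ρ` through `finProdFinEquiv`. [folklore] -/
def prodPerm (ρ : Equiv.Perm (Fin m)) : Equiv.Perm (Fin (m * m)) :=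
  finProdFinEquiv.symm.trans ((Equiv.prodCongr ρ ρ).trans finProdFinEquiv)

/-- Decoding `prodPerm ρ p`. [folklore] -/
theorem symm_prodPerm (ρ : Equiv.Perm (Fin m)) (p : Fin (m * m)) :
    finProdFinEquiv.symm (prodPerm ρ p) = (ρ (finProdFinEquiv.symm p).1, ρ (finProdFinEquiv.symm p).2) := by
  simp [prodPerm]

variable (ρ : Equiv.Perm (Fin m)) (o : Fin m × Fin m)

/-- The relabelling of wires induced by `ρ`. [folklore] -/
abbrev F (ρ : Equiv.Perm (Fin m)) : W m T → W m T := Sum.map (diag ρ) (actEquiv (T := T) ρ)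

/-- **Renaming vertices is an automorphism**: `act ρ`, over the diagonal action of `ρ` on the
inputs, is an automorphism of the DAG, for EVERY vertex permutation `ρ`. [cite: AndersonDawar2016, Def. 6–7] -/
theorem crDAG_isAut : (crDAG m T o).IsAut (diag ρ) (actEquiv ρ) := by
  refine ⟨rfl, fun l => by cases l <;> rfl, fun l => ?_⟩
  show (List.ofFn (Node.args (act ρ l))).Perm ((List.ofFn (Node.args l)).map (F ρ))
  cases l with
  | tt => exact perm_of_eq (n := 0) fun a => a.elim0
  | ff => exact perm_of_eq (n := 0) fun a => a.elim0
  | e u v => exact perm_of_eq (n := 2) fun a => by simp only [act, args]; split_ifs <;> rfl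
  | adj u v =>
    refine perm_of_eq (n := 2) fun a => ?_
    simp only [act, args, ρ.injective.eq_iff]
    split_ifs <;> rfl
  | eq t u v =>
    rcases t with ⟨_ | t, ht⟩
    · exact perm_of_eq (n := m + 1) fun a => rfl
    · refine perm_of_comp_eq (n := m + 1) (consPerm ρ) fun a => ?_
      show F ρ ((Fin.cons (Sum.inr (eq ⟨t, by omega⟩ u v))
          (fun k => Sum.inr (ceq ⟨t, by omega⟩ u v k)) : Fin (m + 1) → W m T) a) =
        (Fin.cons (Sum.inr (eq ⟨t, by omega⟩ (ρ u) (ρ v)))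
          (fun k => Sum.inr (ceq ⟨t, by omega⟩ (ρ u) (ρ v) k)) : Fin (m + 1) → W m T) (consPerm ρ a)
      rw [cons_consPerm]
      refine Fin.cases ?_ (fun k => ?_) a <;> rfl
  | lt t u v =>
    rcases t with ⟨_ | t, ht⟩
    · exact perm_of_eq (n := 2) fun a => rfl
    · exact perm_of_eq (n := 2) fun a => by simp only [act, args]; split_ifs <;> rfl
  | ae t u w' w => exact perm_of_eq (n := 2) fun a => by simp only [act, args]; split_ifs <;> rfl
  | nae t u w' w => exact perm_of_eq (n := 1) fun a => rfl
  | cge t u v w =>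
    refine perm_of_comp_eq (n := m + m) (blockPerm ρ ρ) fun a => ?_
    simp only [act, args]
    rw [append_blockPerm]
    induction a using Fin.addCases with
    | left i => simp only [Fin.append_left]; rfl
    | right j => simp only [Fin.append_right]; rfl
  | ceq t u v w => exact perm_of_eq (n := 2) fun a => by simp only [act, args]; split_ifs <;> rfl
  | clt t u v w => exact perm_of_eq (n := 1) fun a => rfl
  | nlt t w' w => exact perm_of_eq (n := 1) fun a => rfl
  | imp t u v w w' => exact perm_of_eq (n := 2) fun a => by simp only [act, args]; split_ifs <;> rfl
  | allb t u v w => exact perm_of_comp_eq (n := m) ρ fun a => rfl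
  | lexw t u v w => exact perm_of_eq (n := 2) fun a => by simp only [act, args]; split_ifs <;> rfl
  | lex t u v => exact perm_of_comp_eq (n := m) ρ fun a => rfl
  | lt2 t u v => exact perm_of_eq (n := 2) fun a => by simp only [act, args]; split_ifs <;> rfl
  | rge u i =>
    refine perm_of_comp_eq (n := m + m) (blockPerm ρ 1) fun a => ?_
    simp only [act, args]
    rw [append_blockPerm]
    induction a using Fin.addCases with
    | left v => simp only [Fin.append_left]; rfl
    | right k =>
      simp only [Fin.append_right, Function.comp_apply, Equiv.Perm.coe_one, id_eq]
      split_ifs <;> rfl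
  | nrge u i => exact perm_of_eq (n := 1) fun a => rfl
  | rk u i => exact perm_of_eq (n := 2) fun a => by simp only [act, args]; split_ifs <;> rfl
  | yt i j u v => exact perm_of_eq (n := 3) fun a => by simp only [act, args]; split_ifs <;> rfl
  | y i j =>
    refine perm_of_comp_eq (n := m * m) (prodPerm ρ) fun a => ?_
    simp only [act, args]
    rw [symm_prodPerm]
    rfl

/-- **The DAG is symmetric under every set of vertex permutations.** [cite: AndersonDawar2016, Def. 7] -/
theorem crDAG_isSymm (Γ : Set (Equiv.Perm (Fin m))) : (crDAG m T o).IsSymm (GateDAG.diagMaps Γ) := by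
  rintro π ⟨ρ', -, rfl⟩
  exact ⟨actEquiv ρ', (coe_diag ρ') ▸ crDAG_isAut ρ' o⟩

/-- **The compiled straight-line circuit is `Γ`-symmetric**, for every `Γ` (in particular under
ALL of `Sym(Fin m)`). [cite: AndersonDawar2016, Thm 1 (FPC to symmetric circuits)] -/
theorem compile_crDAG_isSymmetricUnder (Γ : Set (Equiv.Perm (Fin m))) :
    (crDAG m T o).compile.IsSymmetricUnder Γ :=
  (GateDAG.isSymmetricUnder_compile_iff _ Γ).2 (crDAG_isSymm o Γ)

/-- The compiled circuit is over `tcBasis`. [folklore] -/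
theorem compile_crDAG_isOver : (crDAG m T o).compile.IsOver tcBasis :=
  GateDAG.compile_isOver _ (crDAG_fn_mem_tcBasis o)

/-- The compiled circuit has at most `22·(m+1)⁴·(T+1)` gates. [folklore] -/
theorem compile_crDAG_size_le : (crDAG m T o).compile.size ≤ 22 * ((m + 1) ^ 4 * (T + 1)) := by
  rw [Circuit.size, GateDAG.compile_gates_length]
  exact card_node_le m T

end Symmetry

end SymCR

end Literature.Computability.Complexity
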